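import Summits.KontsevichZagierPeriods.KontsevichZagierPeriods.Theses.LiftingCriteria
import Summits.KontsevichZagierPeriods.KontsevichZagierPeriods.Theorems.LiftingCriteriaDilationTransferOfFibreKernel

/-!
# `DilationTransfer` (stmt-KontsevichZagierPeriods-3572, route LiftingCriteria) — birth skeleton, RESHAPE 4

Crux (verbatim the route decl `…Theses.LiftingCriteria.DilationTransfer`): a functional relation
`m₀ + Σ mᵢ v_{gᵢ}(ϖ) = (ϖ − ϖ₀)(μ₀(ϖ) + Σ μⱼ(ϖ) v_{Gⱼ}(ϖ))` on `[0,1]` among dilation functions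
`v_g(ϖ) = ∫_{[0,1]ⁿ} g(ϖz) dz` of cube-Nash integrands, specialised at a rational `ϖ₀ ∈ (0,1]`, is a
KZ relation: `m₀·[1] + Σ mᵢ·[∫_cube gᵢ(ϖ₀ z)dz] ∈ KZ.relations`.

## The line `birth` and its four reshapes

The line (registrar + leads c1, c2, c3): the pencil integrand `F(z,ϖ)` is born at `ϖ = 0` and
continued to `ϖ₀`; a certificate for `F` in MORE variables, specialised / transported to `ϖ₀`,
is calibrated into `KZ.relations`. History:
* registrar (2026-08-17): S1 `stub_pencilStokesGerm` (Nash Stokes germ at `ϖ = 0`, Ayoub Thm 1.7)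
  + S2 `stub_pencilContinuation`; assembly `DilationTransfer_of` proved.
* c1, reshapes 1–2: S2 ↦ S2a (identity theorem, LANDED p149141) + S2b (slicing, LANDED p147119);
  dimension `≤ 1` landed unconditionally (p149819, p150111, p151143); verdict promote-stub on S1.
* c2, reshape 3: assembly landed (`dilationTransfer_of_tameStokes`,
  `dilationTransfer_of_pencilStokesGerm`, p154167; rational dim ≤ 1 with arbitrary witness,
  p154490); single stub `stub_pencilTameStokes` = a TAME STOKES NORMAL FORM of the specialised
  integrand `f₀` (Ayoub elements `∂_cH − H|₁ + H|₀`, `H` Nash near a closed cube); verdict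
  promote-stub (Stokes-completeness for the pencil; Ayoub revisited Rem. 1.17 open).
* c3, reshape 4 (this file): the tame normal form is a straitjacket the crux does not ask for —
  the crux only wants `∈ KZ.relations` (all four moves). Already the permutation datum
  `g₁ = a, g₂ = a∘σ, m = (1,−1)` (relation `v_a − v_{a∘σ} ≡ 0`; crux true by ONE change of
  variables) asks reshape 3 to write `a(x,y) − a(y,x)` as a sum of tame `relA`'s, which is neither
  provable nor refutable today. Reshape 4 replaces it by the weakest residual of the composition,
  through two LANDED transfers:
  - `dilationTransfer_of_pencilCubeKernel` (p157243, `Theorems/…OfCubeKernel.lean`): the crux from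
    "`[[0,1]^D, f₀∘π] ∈ relations`" (four-move recombination, no calibration);
  - `dilationTransfer_of_pencilFibreKernel` (`Theorems/…OfFibreKernel.lean`): Newton–Leibniz in the
    PARAMETER. With the parameter rescaled (`ϖ = ϖ₀s`) the pencil integrand
    `P(x,s) = m₀ + Σ mᵢ gᵢ(ϖ₀s·πᵢx) − (ϖ₀s − ϖ₀)(μ₀(ϖ₀s) + Σ μⱼ(ϖ₀s)Gⱼ(ϖ₀s·π'ⱼx))` is Nash near
    `[0,1]^{N+1}` (toolkit `Theorems/…PencilIntegrand.lean`, p157262), `P(x,1) = f₀(x)` and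
    `P(x,0) = 0` IDENTICALLY (the relation at `ϖ = 0`: every dilation integral is the value at the
    origin), so ONE cubical Stokes move gives `[[0,1]^{N+1}, ∂_sP] ≡ [[0,1]^N, f₀∘π]`.
  The single stub is therefore `stub_pencilFibreKernel`: every cube representation of a
  last-coordinate derivative `P'` of `P` is a relation. Its VALUE is `∫ P' = ∫ f₀ − 0 = 0`, and all
  its fibre integrals vanish: `∫_{[0,1]^N} P'(x,s)dx = d/ds(ϖ₀^{…}·relation at ϖ₀s) = 0` — it is the
  RELATIVE Kontsevich–Zagier property of the pencil (fibrewise-null family ⇒ relation), with the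
  whole four-move calculus available to prove it.

## Status of the remaining stub (census, lead c3)

`stub_pencilFibreKernel` is summit-implied (Fubini + kernel conjecture) and is, at the motivic
level, Ayoub's relative theorem (Ann. of Math. 181 (2015) Thm. 1.2); what separates it from a proof
in the tree is the specialisation of relative certificates to the closed parameter interval — the
loss "the fibre primitive leaves the semialgebraic class" that crux `CubeKernelStep` (route
UnfoldedStokes, item 17854) isolates. Provable layers, LANDED as `--supports` rungs of this crux:
dimension ≤ 1 (c1/c2: p151143, p154490); HOMOGENEOUS relations (`m₀ + Σ mᵢ v_{gᵢ} ≡ 0`) with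
`nᵢ ≤ 2` whose symmetrisation on the triangle is EXACT (`dilationTransfer_homog_dim_two_exactSym`,
all permutation / antisymmetric data) or EXACT + CLOSED-LOOP logarithmic
(`dilationTransfer_homog_dim_two_closedLoops`), via the pyramid decomposition (`square_pyramid`,
p159007), the scale packages at every rational scale (`homog_scale_moves_rem`, p160627), density +
fundamental theorem of calculus (`cubeKernel_of_scalePackages`) and the transcendence-free unfolding
of closed loops (`triangle_closedLoop_dlog_mem_relations`). The rational homogeneous `N = 2` layer
is thereby reduced to Hermite reduction over `ℚ(s)` + function-field Baker (Ax + Baker, both tree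
facts) — not yet in the tree in usable form; non-homogeneous witnesses keep the stub at relative-KZ
strength (memos `Lines/birth-c3-census.md`, `Lines/birth-c3b-rungs.md`).

Disproof used: none — `ledger crux ls stmt-KontsevichZagierPeriods-3572` (2026-08-17T11:10Z) lists no
`Disproof.lean`, no `Negative/*`, no ideas. Barriers: `noSemialgebraicPrimitive_inv_sub_two` is
respected (the only primitive used is `P` itself, in the PARAMETER direction, Nash by construction;
no fibre primitive is posited); the `kzConjecture_implies_*` strength barriers are engaged by the
stub exactly as by the crux (both are summit-implied and imply nothing about odd zeta values).
-/

noncomputable section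

-- `Summit.KontsevichZagierPeriods.KontsevichZagierPeriods.…` is the tree's mandated layout (single-conjunct summit).
set_option linter.dupNamespace false

namespace Summit.KontsevichZagierPeriods.KontsevichZagierPeriods.Cruxes.DilationTransfer.Birth

open scoped BigOperators
open Summit.KontsevichZagierPeriods.KontsevichZagierPeriods.Theses.LiftingCriteria (DilationTransfer)
open Summit.KontsevichZagierPeriods.LiftingCriteria.DilationTransfer (dilationTransfer_of_pencilFibreKernel)

/-- **Stub `stub_pencilFibreKernel` — the fibre kernel of the dilation pencil is a relation
(relative Kontsevich–Zagier for the pencil; summit-implied; size XL).** For every datum of the crux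
(cube-Nash `gᵢ` on open `Uᵢ ⊇ [0,1]^{nᵢ}`, integers `mᵢ, m₀`, rational `ϖ₀ ∈ (0,1]`), every
functional-relation witness (`Gⱼ, Vⱼ, μⱼ, μ₀` with the identity on `[0,1]`), every common cube
`[0,1]^N` (`nᵢ, dⱼ ≤ N`) and every function `P'` which is, along the last coordinate and over the
closed cube, a derivative of the rescaled pencil integrand
`P(x,s) = m₀ + Σ mᵢ gᵢ(ϖ₀s·πᵢx) − (ϖ₀s − ϖ₀)(μ₀(ϖ₀s) + Σ μⱼ(ϖ₀s) Gⱼ(ϖ₀s·π'ⱼx))`, every integral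
representation `B` with domain `[0,1]^{N+1}` and integrand `P'` there lies in `KZ.relations`.
Facts available to a prover (tree, `Theorems/LiftingCriteriaDilationTransferPencilIntegrand.lean`):
`P` is real-analytic and `ℚ`-semialgebraic on the open `ℚ`-semialgebraic preimage neighbourhood of
the `Uᵢ, Vⱼ`, which contains the closed cube; `P(x,1) = f₀(x)`; `P(x,0) = 0`; hence
`value B = 0` and every fibre integral `∫_{[0,1]^N} P'(x,s) dx` vanishes (differentiate the relation
at `ϖ₀s`). Why it might fail: it cannot fail without the summit failing (Fubini: value 0 ⇒ kernel
conjecture applies); what can fail is provability inside the four-move calculus without new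
transcendence input above fibre dimension one. [cite: KontsevichZagier2001, §1.2 Conjecture 1]
[cite: Ayoub2015, Thm. 1.2 and Rem. 1.2] -/
theorem stub_pencilFibreKernel :
    ∀ (S : ℕ) (n : Fin S → ℕ) (g : (i : Fin S) → (Fin (n i) → ℝ) → ℝ) (U : (i : Fin S) → Set (Fin (n i) → ℝ)), (∀ i, IsOpen (U i) ∧ Set.pi Set.univ (fun _ : Fin (n i) => Set.Icc (0:ℝ) 1) ⊆ (U i) ∧ Literature.NumberTheory.Transcendental.IsSemialgebraicFunOn ℚ (U i) (g i) ∧ AnalyticOnNhd ℝ (g i) (U i)) → ∀ (m : Fin S → ℤ) (m₀ : ℤ) (ϖ₀ : ℚ), 0 < ϖ₀ → ϖ₀ ≤ 1 → ∀ (T : ℕ) (d : Fin T → ℕ) (G : (j : Fin T) → (Fin (d j) → ℝ) → ℝ) (V : (j : Fin T) → Set (Fin (d j) → ℝ)) (μ : Fin T → Polynomial ℝ) (μ₀ : Polynomial ℝ), (∀ j, IsOpen (V j) ∧ Set.pi Set.univ (fun _ : Fin (d j) => Set.Icc (0:ℝ) 1) ⊆ (V j) ∧ Literature.NumberTheory.Transcendental.IsSemialgebraicFunOn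 ℚ (V j) (G j) ∧ AnalyticOnNhd ℝ (G j) (V j)) → (∀ j k, IsAlgebraic ℚ ((μ j).coeff k)) → (∀ k, IsAlgebraic ℚ (μ₀.coeff k)) → (∀ ϖ ∈ Set.Icc (0:ℝ) 1, (m₀ : ℝ) + ∑ i, (m i : ℝ) * (∫ z in Set.pi Set.univ (fun _ : Fin (n i) => Set.Icc (0:ℝ) 1), g i (ϖ • z)) = (ϖ - (ϖ₀ : ℝ)) * (μ₀.eval ϖ + ∑ j, (μ j).eval ϖ * (∫ z in Set.pi Set.univ (fun _ : Fin (d j) => Set.Icc (0:ℝ) 1), G j (ϖ • z)))) → ∀ (N : ℕ) (hn : ∀ i, n i ≤ N) (hd : ∀ j, d j ≤ N) (P' : (Fin (N + 1) → ℝ) → ℝ), (∀ x ∈ Literature.NumberTheory.Transcendental.KZ.cube N, ∀ t ∈ Set.Icc (0:ℝ) 1, HasDerivAt (fun s : ℝ => (fun w : Fin (N + 1) → ℝ => (m₀ : ℝ) + ∑ i, (m i : ℝ) * g i (((ϖ₀ : ℝ) * w (Fin.last N)) • (fun l : Fin (n i) => w (Fin.castSucc (Fin.castLE (hn i) l))))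 - ((ϖ₀ : ℝ) * w (Fin.last N) - (ϖ₀ : ℝ)) * (μ₀.eval ((ϖ₀ : ℝ) * w (Fin.last N)) + ∑ j, (μ j).eval ((ϖ₀ : ℝ) * w (Fin.last N)) * G j (((ϖ₀ : ℝ) * w (Fin.last N)) • (fun l : Fin (d j) => w (Fin.castSucc (Fin.castLE (hd j) l)))))) (Fin.snoc x s)) (P' (Fin.snoc x t)) t) → ∀ (B : Literature.NumberTheory.Transcendental.KZ.IntegralRep (N + 1)), B.domain = Literature.NumberTheory.Transcendental.KZ.cube (N + 1) → (∀ w ∈ Literature.NumberTheory.Transcendental.KZ.cube (N + 1), B.integrand w = P' w) → Literature.NumberTheory.Transcendental.KZ.of B ∈ Literature.NumberTheory.Transcendental.KZ.relations := by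
  sorry

/-- **The crux from the registered stub, BY NAME** (the skeleton theorem audited by
`ledger skeleton check`: its only `sorry` is inside `stub_pencilFibreKernel`; the composition is the
landed `dilationTransfer_of_pencilFibreKernel`). [cite: KontsevichZagier2001, §1.2 Conjecture 1] -/
theorem DilationTransfer_of_stubs : DilationTransfer :=
  dilationTransfer_of_pencilFibreKernel stub_pencilFibreKernel

end Summit.KontsevichZagierPeriods.KontsevichZagierPeriods.Cruxes.DilationTransfer.Birth
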